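import Summits.ResolutionOfSingularities.ResolutionOfSingularities.Theorems.RadicialJungCleanModelsPBasisMonomialIdeal
import Summits.ResolutionOfSingularities.ResolutionOfSingularities.Theorems.RadicialJungCleanModelsPBasisDualDerivations
import Summits.ResolutionOfSingularities.ResolutionOfSingularities.Theorems.RadicialJungCleanModelsReadOffCriticalRealiser
import HarnessLib

/-!
# [OURS · L W8.1 · T2 brick B7, PART (4)] The constant coefficient of the `p`-basis expansion is a
# SIMULTANEOUS MAXIMISER: `f − f₀ᵖ` lies in every diagonally stable ideal containing the `γ·∂_γ f`
# (Giraud 1983, 1.4 (5), (9): `A(ξ) = sup_g ord_x(f − gᵖ)` is attained by `g = f₀`)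

Programme `PROGRAMME-clean-dim2` / T2 (res-L0-w81-pv-2 g5), spec `HOME/L/res-L0-w81-pv-2/g5/B7-SPEC.md`
§(4) «EXISTENCE OF g»; crux stmt-ResolutionOfSingularities-15917 (`T2Skeleton.lean` v2, stub
`stub_readOff_critical`); `--supports … --as helper` (custody MENU (M-d)). OURS; general algebra in
characteristic `p`; AI-written, weaker than expert review; nothing here is a statement of H. Hironaka's
manuscript.

Setting: a commutative ring `R` of characteristic `p`, a `p`-basis `Γ` of `R` over `R^p` in
Kimura–Niitsuma's sense (`IsPBasisOver p R^p Γ`), the reduced-monomial expansion `f = Σ_b c_b Γ^b`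
(`c_b ∈ R^p`, `RadicialJungCleanModelsPBasisMonomials`) and a family of dual derivations `δ_γ`
(`δ_γ γ = 1`, `δ_γ γ′ = 0`; `RadicialJungCleanModelsPBasisDualDerivations`). Write `f₀ᵖ := c_0` for the
constant coefficient and `g := f₀`.

* § 1 `mul_derivation_mem_span_monomial` — every principal MONOMIAL ideal `(Γ^e)` (`e` any exponent,
  e.g. `xᵃ`, `xᵃyᵇ`) is stable under all the diagonal operators `T_γ = γ·δ_γ`.
* § 2 **`exists_frobeniusRemainder`** — THE MAXIMISER: there is `g ∈ R` such that for EVERY ideal `I`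
  stable under all `T_γ`: (i) if `γ·δ_γ f ∈ I` for all `γ ∈ Γ` then `f − gᵖ ∈ I`; (ii) if `f − g′ᵖ ∈ I`
  for SOME `g′` then `f − gᵖ ∈ I`. Proof: `f − gᵖ = Σ_{b ≠ 0} c_b Γ^b`, `γδ_γ` kills `gᵖ`, and the
  no-cancellation theorem `term_mem_of_mul_derivation_sum_mem` (`…PBasisMonomialIdeal`) puts every
  class `b` with `b γ ≠ 0` into `I`; every `b ≠ 0` has such a `γ`. No primality, locality or
  Noetherian hypothesis is used.
* § 3 δ-free corollaries for the T2 assembler: `exists_forall_monomial_dvd_sub_pow` (monomial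
  divisibility from LOGARITHMIC derivations `γ ∣ D γ`), and the two shapes consumed at a critical
  point with boundary letters `x, y ∈ Γ`:
  **`exists_eq_pow_add_mul_of_logDerivation_dvd`** — if every derivation `D` with `x ∣ D x`, `y ∣ D y`
  has `xᵃyᵇ ∣ D f` (i.e. `J(R, f; log x, y) ⊆ (xᵃyᵇ)`), then `f = gᵖ + u·xᵃ·yᵇ` — with ONE `g` serving
  all `(a, b)` at once and maximal (`xᵃyᵇ ∣ f − g′ᵖ ⇒ xᵃyᵇ ∣ f − gᵖ`); and the non-crossing twin
  **`exists_eq_pow_add_mul_of_logDerivation_dvd₁`** (`x ∣ D x ⇒ xᵃ ∣ D f` gives `f = gᵖ + u·xᵃ`).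
  These are the `hf` inputs of res-L1-s13-pv-1's realiser theorems (B7 PART (3), landing 2).
* § 4 the COMPOSITION with PART (3) (`…ReadOffCriticalRealiser`, p566365):
  **`giraud15NormalFormAt_crossing_of_span_logDerivation_eq`** /
  **`giraud15NormalFormAt_noncrossing_of_span_logDerivation_eq`** — for a two-dimensional regular local
  `𝔽_p`-algebra `O` formally smooth over `𝔽_p` with regular parameters `x, y` lying in a `p`-basis `Γ`
  of `O` over `O^p`: `J(O, f; log x, y) = (xᵃyᵇ)` with `a, b ≥ 2` (resp. `J(O, f; log x) = (xᵃ)`,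
  `a ≥ 2`) ⇒ `Giraud15NormalFormAt p f`. What remains for `stub_readOff_critical` is scheme-to-stalk
  plumbing, «(*) ∧ c = 0 ⇒ J = (xᵃyᵇ), a, b ≥ 2» (spec parts (1)(2)(5)) and the adapted `p`-basis
  (F-96b/F-96f, named facts).

What is NOT here: the `p`-basis of the stalk adapted to the boundary (F-96b/F-96f, named facts), the
computation `J = (xᵃyᵇ)` from «(*) ∧ c = 0» (spec parts (1)(2)), `a ≥ 2` (part (5)).

References: J. Giraud, *Forme normale d'une fonction sur une surface de caractéristique positive*,
Bull. SMF 111 (1983), 1.4 (2), (5), (9) and 2.6 (6) [Giraud1983]; T. Kimura, H. Niitsuma, J. Math. Soc.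
Japan 32 (1980) [KimuraNiitsuma1980]; H. Matsumura, *Commutative Ring Theory* §26 [Matsumura1987].
-/

noncomputable section

set_option linter.dupNamespace false -- mandated namespace of this single-conjunct summit

open IsLocalRing
open Literature.RingTheory.PBasis Literature.AlgebraicGeometry.Resolution

namespace Summit.ResolutionOfSingularities.ResolutionOfSingularities.Theorems.RadicialJung.CleanModels

universe u

section General

variable {p : ℕ} [Fact p.Prime] {R : Type u} [CommRing R] [CharP R p] {Γ : Set R}

section Dual

variable (δ : Γ → Derivation ℤ R R) (hδ₁ : ∀ γ : Γ, δ γ (γ : R) = 1)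
  (hδ₀ : ∀ γ γ' : Γ, γ' ≠ γ → δ γ (γ' : R) = 0)

/-! ## § 1 Principal monomial ideals are stable under the diagonal operators -/

include hδ₁ hδ₀ in
/-- **`(Γ^e)` is stable under every `γ·δ_γ`**: `γδ_γ(Γ^e·m) = (e γ)·Γ^e·m + Γ^e·γδ_γ m` for every
(not necessarily reduced) exponent `e`; e.g. the ideals `(xᵃ)`, `(xᵃyᵇ)` for `x, y ∈ Γ`. [folklore] -/
theorem mul_derivation_mem_span_monomial (e : Γ →₀ ℕ) (γ : Γ) {v : R}
    (hv : v ∈ Ideal.span {e.prod fun γ n => ((γ : Γ) : R) ^ n}) :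
    (γ : R) * δ γ v ∈ Ideal.span {e.prod fun γ n => ((γ : Γ) : R) ^ n} := by
  obtain ⟨m, rfl⟩ := Ideal.mem_span_singleton'.mp hv
  set s := e.prod fun γ n => ((γ : Γ) : R) ^ n with hs
  have e1 : (γ : R) * δ γ (m * s) = m * ((γ : R) * δ γ s) + s * ((γ : R) * δ γ m) := by
    rw [Derivation.leibniz, smul_eq_mul, smul_eq_mul]; ring
  rw [e1, hs, mul_derivation_monomial (δ γ) γ (hδ₁ γ) (hδ₀ γ) e]
  refine Ideal.add_mem _ (Ideal.mem_span_singleton'.mpr ⟨m * (e γ : R), by ring⟩)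
    (Ideal.mem_span_singleton'.mpr ⟨(γ : R) * δ γ m, by ring⟩)

/-! ## § 2 The maximiser -/

include hδ₁ hδ₀ in
/-- **The constant coefficient of the `p`-basis expansion is a simultaneous maximiser** (Giraud 1983,
1.4 (5), (9); 2.6 (6)). For a `p`-basis `Γ` of `R` over `R^p` with dual derivations `δ_γ` and `f ∈ R`
there is `g ∈ R` (namely `gᵖ = c_0`, the constant coefficient of `f = Σ_b c_b Γ^b`) such that for every
ideal `I` stable under all the operators `v ↦ γ·δ_γ v`:
(i) `γ·δ_γ f ∈ I` for all `γ ∈ Γ` implies `f − gᵖ ∈ I`;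
(ii) `f − g′ᵖ ∈ I` for some `g′ ∈ R` implies `f − gᵖ ∈ I` (apply (i): `γδ_γ` kills `g′ᵖ`).
[cite: Giraud1983, 1.4 (5), (9) and 2.6 (6)] -/
theorem exists_frobeniusRemainder (h : IsPBasisOver p (frobenius R p).range Γ) (f : R) :
    ∃ g : R, ∀ I : Ideal R, (∀ γ : Γ, ∀ v ∈ I, (γ : R) * δ γ v ∈ I) →
      ((∀ γ : Γ, (γ : R) * δ γ f ∈ I) → f - g ^ p ∈ I) ∧
        (∀ g' : R, f - g' ^ p ∈ I → f - g ^ p ∈ I) := by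
  classical
  have hp : p.Prime := Fact.out
  obtain ⟨c, hc⟩ := IsPBasisOver.exists_monomial_expansion h f
  set mon : {b : Γ →₀ ℕ // ∀ γ, b γ < p} → R :=
    fun b => (b.1).prod fun γ n => ((γ : Γ) : R) ^ n with hmon
  -- the zero exponent and the constant coefficient `c_0 = g ^ p`
  let b₀ : {b : Γ →₀ ℕ // ∀ γ, b γ < p} := ⟨0, fun _ => hp.pos⟩
  obtain ⟨g, hg⟩ := (c b₀).2
  -- the tail `T = Σ_{b ≠ 0} c_b Γ^b`
  set c' := c.erase b₀ with hc'
  set T : R := ∑ b ∈ c'.support, ((c' b : (frobenius R p).range) : R) * mon b with hT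
  have hmon₀ : mon b₀ = 1 := by simp [hmon, b₀]
  have hfT : f = T + g ^ p := by
    have e1 : (c.sum fun b r => (r : R) * mon b) =
        (c'.sum fun b r => (r : R) * mon b) + (c b₀ : R) * mon b₀ := by
      conv_lhs => rw [← Finsupp.erase_add_single b₀ c]
      rw [Finsupp.sum_add_index' (fun b => by simp) (fun b r₁ r₂ => by simp [add_mul]),
        Finsupp.sum_single_index (by simp)]
    have e2 : (c b₀ : R) = g ^ p := by rw [← hg, frobenius_def]
    rw [← hc, e1, hmon₀, mul_one, e2]
    rfl
  -- every class of the tail is nonzero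
  have hne : ∀ b ∈ c'.support, ∃ γ : Γ, b.1 γ ≠ 0 := by
    intro b hb
    rw [hc', Finsupp.support_erase, Finset.mem_erase] at hb
    by_contra hcon
    push Not at hcon
    exact hb.1 (Subtype.ext (Finsupp.ext hcon))
  refine ⟨g, fun I hI => ?_⟩
  -- (i)
  have key : (∀ γ : Γ, (γ : R) * δ γ f ∈ I) → f - g ^ p ∈ I := by
    intro hf
    have hfg : f - g ^ p = T := by rw [hfT]; ring
    rw [hfg]
    refine Ideal.sum_mem _ fun b hb => ?_
    obtain ⟨γ, hγ⟩ := hne b hb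
    have hγT : (γ : R) * δ γ (∑ b ∈ c'.support, ((c' b : (frobenius R p).range) : R) * mon b) ∈ I := by
      have : (γ : R) * δ γ f = (γ : R) * δ γ T := by
        rw [hfT, map_add, derivation_pow_char (p := p) (δ γ) g, add_zero]
      rw [← hT, ← this]
      exact hf γ
    exact term_mem_of_mul_derivation_sum_mem δ hδ₁ hδ₀ I hI γ c'.support (fun b => c' b) hγT b hb hγ
  refine ⟨key, fun g' hg' => key fun γ => ?_⟩
  -- (ii): `γ δ_γ f = γ δ_γ (f - g'^p) ∈ I`
  have : (γ : R) * δ γ f = (γ : R) * δ γ (f - g' ^ p) := by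
    rw [map_sub, derivation_pow_char (p := p) (δ γ) g', sub_zero]
  rw [this]
  exact hI γ _ hg'

end Dual

/-! ## § 3 δ-free corollaries: monomial divisibility from logarithmic derivations -/

/-- **Monomial divisibility of `f − gᵖ` from logarithmic derivations.** For a `p`-basis `Γ` of `R` over
`R^p` and `f ∈ R` there is ONE `g ∈ R` such that for EVERY exponent `e : Γ →₀ ℕ` (monomial
`Γ^e = ∏ γ^{e γ}`): (i) if `Γ^e ∣ D f` for every derivation `D` of `R` that is logarithmic along `Γ`
(`γ ∣ D γ` for all `γ ∈ Γ`; e.g. `D = γ·δ_γ`), then `Γ^e ∣ f − gᵖ`; (ii) `Γ^e ∣ f − g′ᵖ` for some `g′`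
implies `Γ^e ∣ f − gᵖ` (Giraud's `A(ξ) = sup_g ord_x(f − gᵖ) = ord_x(f − f₀ᵖ)`).
[cite: Giraud1983, 1.4 (5), (9)] -/
theorem exists_forall_monomial_dvd_sub_pow (h : IsPBasisOver p (frobenius R p).range Γ) (f : R) :
    ∃ g : R, ∀ e : Γ →₀ ℕ,
      ((∀ D : Derivation ℤ R R, (∀ γ : Γ, (γ : R) ∣ D (γ : R)) →
          (e.prod fun γ n => ((γ : Γ) : R) ^ n) ∣ D f) →
        (e.prod fun γ n => ((γ : Γ) : R) ^ n) ∣ f - g ^ p) ∧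
      (∀ g' : R, (e.prod fun γ n => ((γ : Γ) : R) ^ n) ∣ f - g' ^ p →
        (e.prod fun γ n => ((γ : Γ) : R) ^ n) ∣ f - g ^ p) := by
  obtain ⟨δ, hδ₁, hδ₀⟩ := IsPBasisOver.exists_dual_derivations h
  obtain ⟨g, hg⟩ := exists_frobeniusRemainder δ hδ₁ hδ₀ h f
  refine ⟨g, fun e => ?_⟩
  set s := e.prod fun γ n => ((γ : Γ) : R) ^ n with hs
  have hI := hg (Ideal.span {s}) (fun γ v hv => mul_derivation_mem_span_monomial δ hδ₁ hδ₀ e γ hv)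
  refine ⟨fun hD => ?_, fun g' hg' => ?_⟩
  · refine Ideal.mem_span_singleton.mp (hI.1 fun γ => Ideal.mem_span_singleton.mpr ?_)
    -- the logarithmic derivation `γ · δ_γ`
    have hlog : ∀ γ' : Γ, (γ' : R) ∣ ((γ : R) • δ γ) (γ' : R) := by
      intro γ'
      rw [Derivation.smul_apply, smul_eq_mul]
      by_cases hγ' : γ' = γ
      · rw [hγ', hδ₁]; simp
      · rw [hδ₀ γ γ' hγ', mul_zero]; exact dvd_zero _
    have := hD ((γ : R) • δ γ) hlog
    rwa [Derivation.smul_apply, smul_eq_mul] at this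
  · exact Ideal.mem_span_singleton.mp (hI.2 g' (Ideal.mem_span_singleton.mpr hg'))

/-- The monomial with exponent `a·e_x + b·e_y` is `xᵃ·yᵇ`. [folklore] -/
theorem monomial_single_add_single {x y : R} (hx : x ∈ Γ) (hy : y ∈ Γ) (a b : ℕ) :
    ((Finsupp.single (⟨x, hx⟩ : Γ) a + Finsupp.single (⟨y, hy⟩ : Γ) b).prod
        fun γ n => ((γ : Γ) : R) ^ n) = x ^ a * y ^ b := by
  rw [monomial_add,
    Finsupp.prod_single_index (h := fun (γ : Γ) (n : ℕ) => ((γ : Γ) : R) ^ n) (pow_zero _),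
    Finsupp.prod_single_index (h := fun (γ : Γ) (n : ℕ) => ((γ : Γ) : R) ^ n) (pow_zero _)]

/-- **B7 PART (4), crossing shape: `f = gᵖ + u·xᵃ·yᵇ`.** Let `Γ` be a `p`-basis of `R` over `R^p`
containing the two boundary letters `x ≠ y`, and `f ∈ R`. There is ONE `g ∈ R` (the constant
coefficient `f₀` of the expansion) such that for all `a, b`: (i) if every derivation `D` logarithmic
along `x` and `y` (`x ∣ D x`, `y ∣ D y`) satisfies `xᵃyᵇ ∣ D f` — i.e. `J(R, f; log x, y) ⊆ (xᵃyᵇ)` —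
then `f = gᵖ + u·(xᵃ·yᵇ)` for some `u`; (ii) `xᵃyᵇ ∣ f − g′ᵖ` for some `g′` implies `xᵃyᵇ ∣ f − gᵖ`
(`g` realises both maxima `A(ξ)`, `B(ξ)` at once). This is the `hf` input of the crossing realiser
theorem of B7 PART (3). [cite: Giraud1983, 1.4 (5), (9); Prop. 1.5 p. 113] -/
theorem exists_eq_pow_add_mul_of_logDerivation_dvd (h : IsPBasisOver p (frobenius R p).range Γ)
    {x y : R} (hx : x ∈ Γ) (hy : y ∈ Γ) (f : R) :
    ∃ g : R, ∀ a b : ℕ,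
      ((∀ D : Derivation ℤ R R, x ∣ D x → y ∣ D y → x ^ a * y ^ b ∣ D f) →
          ∃ u : R, f = g ^ p + u * (x ^ a * y ^ b)) ∧
      (∀ g' : R, x ^ a * y ^ b ∣ f - g' ^ p → x ^ a * y ^ b ∣ f - g ^ p) := by
  obtain ⟨g, hg⟩ := exists_forall_monomial_dvd_sub_pow h f
  refine ⟨g, fun a b => ?_⟩
  have he := hg (Finsupp.single (⟨x, hx⟩ : Γ) a + Finsupp.single (⟨y, hy⟩ : Γ) b)
  rw [monomial_single_add_single hx hy a b] at he
  refine ⟨fun hJ => ?_, he.2⟩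
  obtain ⟨u, hu⟩ := he.1 fun D hD => hJ D (hD ⟨x, hx⟩) (hD ⟨y, hy⟩)
  exact ⟨u, by rw [← sub_eq_iff_eq_add', hu]; ring⟩

/-- **B7 PART (4), non-crossing shape: `f = gᵖ + u·xᵃ`.** With one boundary letter `x ∈ Γ`: there is
ONE `g ∈ R` such that for all `a`: (i) if every derivation `D` with `x ∣ D x` satisfies `xᵃ ∣ D f`
(`J(R, f; log x) ⊆ (xᵃ)`) then `f = gᵖ + u·xᵃ` for some `u`; (ii) `xᵃ ∣ f − g′ᵖ ⇒ xᵃ ∣ f − gᵖ`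
(`A(ξ) = ord_x(f − gᵖ)`). [cite: Giraud1983, 1.4 (5), (9); Prop. 1.5 p. 113] -/
theorem exists_eq_pow_add_mul_of_logDerivation_dvd₁ (h : IsPBasisOver p (frobenius R p).range Γ)
    {x : R} (hx : x ∈ Γ) (f : R) :
    ∃ g : R, ∀ a : ℕ,
      ((∀ D : Derivation ℤ R R, x ∣ D x → x ^ a ∣ D f) → ∃ u : R, f = g ^ p + u * x ^ a) ∧
      (∀ g' : R, x ^ a ∣ f - g' ^ p → x ^ a ∣ f - g ^ p) := by
  obtain ⟨g, hg⟩ := exists_forall_monomial_dvd_sub_pow h f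
  refine ⟨g, fun a => ?_⟩
  have he := hg (Finsupp.single (⟨x, hx⟩ : Γ) a)
  rw [Finsupp.prod_single_index (h := fun (γ : Γ) (n : ℕ) => ((γ : Γ) : R) ^ n) (pow_zero _)] at he
  refine ⟨fun hJ => ?_, he.2⟩
  obtain ⟨u, hu⟩ := he.1 fun D hD => hJ D (hD ⟨x, hx⟩)
  exact ⟨u, by rw [← sub_eq_iff_eq_add', hu]; ring⟩

end General

/-! ## § 4 Composition with B7 PART (3): the read-off at a critical point, modulo the adapted `p`-basis -/

/-- **B7 PARTS (3)+(4), crossing point: `J(O, f; log x, y) = (xᵃyᵇ)` with `a, b ≥ 2` puts `f` in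
Giraud's normal form**, for a two-dimensional regular local `𝔽_p`-algebra `O`, formally smooth over
`𝔽_p`, with regular parameters `x, y` that belong to a `p`-basis `Γ` of `O` over `O^p` (the ADAPTED
`p`-basis — Kimura–Niitsuma 1980 Thm 3.1 / Lemma 2.6, the tree's named facts F-96b/F-96f, to be
supplied by the assembler): the maximiser `g = f₀` of § 3 gives `f = gᵖ + u·(xᵃyᵇ)`, and
res-L1-s13-pv-1's `giraud15NormalFormAt_crossing_of_realiser` (PART (3)) reads the normal form off it.
[cite: Giraud1983, Prop. 1.5 (i) ⇒ (ii), p. 113] -/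
theorem giraud15NormalFormAt_crossing_of_span_logDerivation_eq (p : ℕ) [Fact p.Prime] {O : Type u}
    [CommRing O] [IsRegularLocalRing O] [Algebra (ZMod p) O] [Algebra.FormallySmooth (ZMod p) O]
    [CharP O p] (hdim : ringKrullDim O = 2) {Γ : Set O}
    (hΓ : IsPBasisOver p (frobenius O p).range Γ) {x y f : O} (hx : x ∈ Γ) (hy : y ∈ Γ)
    (hxy : Ideal.span {x, y} = maximalIdeal O) {a b : ℕ} (ha : 2 ≤ a) (hb : 2 ≤ b)
    (hJ : Ideal.span {v : O | ∃ D : Derivation ℤ O O, x ∣ D x ∧ y ∣ D y ∧ D f = v} =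
      Ideal.span {x ^ a * y ^ b}) :
    Giraud15NormalFormAt p f := by
  obtain ⟨g, hg⟩ := exists_eq_pow_add_mul_of_logDerivation_dvd hΓ hx hy f
  obtain ⟨u, hu⟩ := (hg a b).1 fun D hDx hDy => by
    have h1 : D f ∈ Ideal.span {x ^ a * y ^ b} := by
      rw [← hJ]; exact Ideal.subset_span ⟨D, hDx, hDy, rfl⟩
    exact Ideal.mem_span_singleton.mp h1
  have h2 : x ^ a * y ^ b ∈
      Ideal.span {v : O | ∃ D : Derivation ℤ O O, x ∣ D x ∧ y ∣ D y ∧ D f = v} := by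
    rw [hJ]; exact Ideal.mem_span_singleton_self _
  exact giraud15NormalFormAt_crossing_of_realiser p hdim hxy hu ha hb h2

/-- **B7 PARTS (3)+(4), non-crossing point: `J(O, f; log x) = (xᵃ)` with `a ≥ 2` puts `f` in Giraud's
normal form** (same setting; only `x ∈ Γ` is used for the maximiser, `y` completes the regular system
of parameters). [cite: Giraud1983, Prop. 1.5 (i) ⇒ (ii), p. 113] -/
theorem giraud15NormalFormAt_noncrossing_of_span_logDerivation_eq (p : ℕ) [Fact p.Prime]
    {O : Type u} [CommRing O] [IsRegularLocalRing O] [Algebra (ZMod p) O]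
    [Algebra.FormallySmooth (ZMod p) O] [CharP O p] (hdim : ringKrullDim O = 2) {Γ : Set O}
    (hΓ : IsPBasisOver p (frobenius O p).range Γ) {x y f : O} (hx : x ∈ Γ)
    (hxy : Ideal.span {x, y} = maximalIdeal O) {a : ℕ} (ha : 2 ≤ a)
    (hJ : Ideal.span {v : O | ∃ D : Derivation ℤ O O, x ∣ D x ∧ D f = v} = Ideal.span {x ^ a}) :
    Giraud15NormalFormAt p f := by
  obtain ⟨g, hg⟩ := exists_eq_pow_add_mul_of_logDerivation_dvd₁ hΓ hx f
  obtain ⟨u, hu⟩ := (hg a).1 fun D hDx => by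
    have h1 : D f ∈ Ideal.span {x ^ a} := by
      rw [← hJ]; exact Ideal.subset_span ⟨D, hDx, rfl⟩
    exact Ideal.mem_span_singleton.mp h1
  have h2 : x ^ a ∈ Ideal.span {v : O | ∃ D : Derivation ℤ O O, x ∣ D x ∧ D f = v} := by
    rw [hJ]; exact Ideal.mem_span_singleton_self _
  exact giraud15NormalFormAt_noncrossing_of_realiser p hdim hxy hu ha h2

end Summit.ResolutionOfSingularities.ResolutionOfSingularities.Theorems.RadicialJung.CleanModels

end
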